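import Summits.BirchSwinnertonDyer.BirchSwinnertonDyer.Theorems.PAdicOrderV2PAdicOrderComparisonR2StubParity
import Summits.BirchSwinnertonDyer.BirchSwinnertonDyer.Theorems.PAdicOrderV2PAdicOrderComparisonR2StubTwoLeOrder
import Summits.BirchSwinnertonDyer.BirchSwinnertonDyer.Theorems.PAdicOrderV2PAdicOrderThesisR2StubUBRank0
import Literature.NumberTheory.EllipticCurves.OrdinaryPrimesProofs

/-!
# BirchSwinnertonDyer / PAdicOrderV2 — crux `PAdicOrderThesisR2` (stmt-0487), line `Sketch`:
# the proved envelope of stub `stub_UB_pos` — `ord_{T=0} L_p(E,T)` is finite, has the parity of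
# `r_an`, and can miss the upper bound `ord ≤ r_an` only by an even defect `≥ 2`

`stub_UB_pos` (open; registered stub of `Cruxes/PAdicOrderThesisR2/Lines/Sketch.lean`) asks, for
`E/ℚ` (globally minimal `W`) of positive analytic rank, for ONE good ordinary prime `p ≥ 5` with
`ord_{T=0} L_p(f, α_p, T) ≤ r_an(E)` for every newform `f` of `E`. This file records, sorry-free
and WITHOUT any named fact, how much of it the tree proves at EVERY good ordinary prime `p`
(`p = 2, 3` included) and for the newform `f` of `E` at any level:

* `order_padicLFunction_lt_top` — `ord_{T=0} L_p(E,T) < ⊤`: the unit-root `p`-adic `L`-function is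
  not the zero series (`padicLFunction_ne_zero_holds`: Rohrlich's non-vanishing of twists, here
  through the tree's first-moment theorem, + Mazur–Tate–Teitelbaum interpolation). So the two
  equalities of `X` compare natural numbers; no `⊤ = ↑n` junk is reachable on the ordinary locus
  (contrast the disprover's `order_padicLFunction_eq_top_of_dvd` at `p ∣ a_p`).
* `exists_order_padicLFunction_eq_natCast` — `ord_{T=0} L_p(E,T) = n` for a natural number `n`
  with `n ≡ r_an (mod 2)` (`stub_even_order_iff_even_analyticRank`: the `p`-adic and the complex
  functional equations have the same sign `-ε(f)`, Greenberg LNM 1716 §5) and `n = 0 ↔ r_an = 0`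
  (`order_padicLFunction_eq_zero_iff_analyticRank_eq_zero`: interpolation at the trivial
  character, `α_p ≠ 1`).
* `order_le_analyticRank_or_add_two_le` — DICHOTOMY: `ord ≤ r_an` or `r_an + 2 ≤ ord`. Hence
  `order_le_analyticRank_iff_lt_add_two`: the upper bound of `stub_UB_pos` at `p` is EQUIVALENT to
  `ord < r_an + 2`, i.e. to `T^{r_an + 2} ∤ L_p(E,T)` — an open condition, certifiable at finite
  `p`-adic and `T`-adic precision curve by curve (Stein–Wuthrich 2013, §3), and the only way the
  stub can fail at a prime is by an even defect of at least `2`.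
* `analyticRank_le_order_of_analyticRank_le_two`, `order_eq_analyticRank_or_add_two_le_of_analyticRank_le_two`
  — for `r_an ≤ 2` the lower bound `r_an ≤ ord` is a theorem (`one_le_order_…`, `stub_two_le_order_…`),
  so there `ord = r_an` or `r_an + 2 ≤ ord`: crux #2's comparison at `(E, p)` is exactly
  `T^{r_an+2} ∤ L_p(E,T)`; in analytic rank one: `ord = 1 ∨ 3 ≤ ord`
  (`order_eq_one_or_three_le_of_analyticRank_eq_one`), i.e. the weak rank-one Schneider statement
  at `p` is `T³ ∤ L_p(E,T)`.
* `stub_UB_pos_envelope` — the PROVED part of `stub_UB_pos`, with its quantifier shape: for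
  `r_an > 0` there is a good ordinary `p ≥ 5` (`exists_good_ordinary_prime_holds`, Serre 1981 §8)
  at which, for every newform `f`, `1 ≤ ord < ⊤`, `ord ≡ r_an (mod 2)` and the dichotomy holds.
* `stub_UB_pos_of_order_lt_add_two` — consequently `stub_UB_pos` (verbatim registered signature)
  follows from the formally weaker one-prime statement `∃ p, ∀ f, ord < r_an + 2`.

Nothing here is asserted about `X` or about `stub_UB_pos` itself; every theorem is unconditional.
-/

-- single-conjunct summit: `Summit.BirchSwinnertonDyer.BirchSwinnertonDyer.…` repeats the name by design
set_option linter.dupNamespace false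

namespace Summit.BirchSwinnertonDyer.BirchSwinnertonDyer.Cruxes.PAdicOrderThesisR2.KatoSandwich

open Literature.NumberTheory.EllipticCurves Literature.NumberTheory.EllipticCurves.ModularForms
open Summit.BirchSwinnertonDyer.BirchSwinnertonDyer.Theorems

variable (W : WeierstrassCurve ℚ) [W.IsElliptic] [W.IsGloballyMinimal] (p : ℕ) [Fact p.Prime]

/-- **`ord_{T=0} L_p(E,T)` is finite at every good ordinary prime.** For `E = W/ℚ` elliptic and
globally minimal, `p` good ordinary and `f` the newform of `E` (any level), the unit-root `p`-adic
`L`-function `L_p(f, α_p, T)` is not the zero power series (`padicLFunction_ne_zero_holds`: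
Rohrlich 1984 via interpolation, Mazur–Tate–Teitelbaum 1986 §I.14), so its `T`-order is `< ⊤`.
[cite: RohrlichInventiones1984, Theorem (p. 409)] -/
theorem order_padicLFunction_lt_top (hord : IsOrdinaryAt W p) {N : ℕ} [NeZero N]
    {f : CuspForm (CongruenceSubgroup.Gamma0 N) 2} (hf : IsNewformOf W f) :
    (padicLFunction f (unitRoot W p : ℚ_[p])).order < ⊤ := by
  rw [lt_top_iff_ne_top, Ne, PowerSeries.order_eq_top]
  exact padicLFunction_ne_zero_holds hord hf

/-- **`ord_{T=0} L_p(E,T)` is a natural number with the parity of `r_an`, and is `0` iff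
`r_an = 0`.** At a good ordinary prime `p`, for the newform `f` of `E = W/ℚ`: there is `n : ℕ`
with `ord_{T=0} L_p(f, α_p, T) = n` (`order_padicLFunction_lt_top`), `n ≡ r_an (mod 2)`
(`stub_even_order_iff_even_analyticRank`: the signs of the `p`-adic and complex functional
equations agree, Greenberg LNM 1716, §5, p. 181) and `n = 0 ↔ r_an = 0`
(`order_padicLFunction_eq_zero_iff_analyticRank_eq_zero`: interpolation at the trivial character,
`L_p(E,0) = (1 - α_p⁻¹)² L(E,1)/Ω⁺` with `α_p ≠ 1`). [cite: GreenbergLNM1716, §5 (p. 181)] -/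
theorem exists_order_padicLFunction_eq_natCast (hord : IsOrdinaryAt W p) {N : ℕ} [NeZero N]
    {f : CuspForm (CongruenceSubgroup.Gamma0 N) 2} (hf : IsNewformOf W f) :
    ∃ n : ℕ, (padicLFunction f (unitRoot W p : ℚ_[p])).order = n ∧
      (Even n ↔ Even W.analyticRank) ∧ (n = 0 ↔ W.analyticRank = 0) := by
  have h0 : padicLFunction f (unitRoot W p : ℚ_[p]) ≠ 0 := padicLFunction_ne_zero_holds hord hf
  refine ⟨(padicLFunction f (unitRoot W p : ℚ_[p])).order.toNat,
    (PowerSeries.coe_toNat_order h0).symm, stub_even_order_iff_even_analyticRank W p hord f hf, ?_⟩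
  rw [← order_padicLFunction_eq_zero_iff_analyticRank_eq_zero W p hord hf,
    ← PowerSeries.coe_toNat_order h0]
  exact_mod_cast Iff.rfl

/-- **Dichotomy: the upper bound holds at `p`, or fails by an even defect `≥ 2`.** At a good
ordinary prime `p`, for the newform `f` of `E = W/ℚ`: either `ord_{T=0} L_p(f, α_p, T) ≤ r_an(E)`
or `r_an(E) + 2 ≤ ord_{T=0} L_p(f, α_p, T)` — the value `r_an + 1` is excluded by parity
(`exists_order_padicLFunction_eq_natCast`). [cite: GreenbergLNM1716, §5 (p. 181)] -/
theorem order_le_analyticRank_or_add_two_le (hord : IsOrdinaryAt W p) {N : ℕ} [NeZero N]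
    {f : CuspForm (CongruenceSubgroup.Gamma0 N) 2} (hf : IsNewformOf W f) :
    (padicLFunction f (unitRoot W p : ℚ_[p])).order ≤ (W.analyticRank : ℕ∞) ∨
      ((W.analyticRank + 2 : ℕ) : ℕ∞) ≤ (padicLFunction f (unitRoot W p : ℚ_[p])).order := by
  obtain ⟨n, hn, hpar, -⟩ := exists_order_padicLFunction_eq_natCast W p hord hf
  rw [hn]
  rcases Nat.lt_or_ge W.analyticRank n with h | h
  · have hne : n ≠ W.analyticRank + 1 := by
      intro h1
      rw [h1, Nat.even_add_one] at hpar
      exact not_iff_self hpar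
    exact Or.inr (by exact_mod_cast (show W.analyticRank + 2 ≤ n by omega))
  · exact Or.inl (by exact_mod_cast h)

/-- **The upper bound at `p` is the open condition `ord < r_an + 2`.** At a good ordinary prime
`p`, for the newform `f` of `E = W/ℚ`: `ord_{T=0} L_p(f, α_p, T) ≤ r_an(E)` iff
`ord_{T=0} L_p(f, α_p, T) < r_an(E) + 2`, i.e. iff `T^{r_an + 2} ∤ L_p(E,T)` — one coefficient among
`[T^0], …, [T^{r_an+1}]` is non-zero, certifiable at finite precision (Stein–Wuthrich 2013, §3).
[cite: GreenbergLNM1716, §5 (p. 181)] -/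
theorem order_le_analyticRank_iff_lt_add_two (hord : IsOrdinaryAt W p) {N : ℕ} [NeZero N]
    {f : CuspForm (CongruenceSubgroup.Gamma0 N) 2} (hf : IsNewformOf W f) :
    (padicLFunction f (unitRoot W p : ℚ_[p])).order ≤ (W.analyticRank : ℕ∞) ↔
      (padicLFunction f (unitRoot W p : ℚ_[p])).order < ((W.analyticRank + 2 : ℕ) : ℕ∞) := by
  constructor
  · intro h
    exact lt_of_le_of_lt h (by exact_mod_cast (show W.analyticRank < W.analyticRank + 2 by omega))
  · intro h
    rcases order_le_analyticRank_or_add_two_le W p hord hf with h' | h'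
    · exact h'
    · exact absurd h (not_lt.mpr h')

/-- **`T^{r_an+2} ∣ L_p(E,T)` is the only failure mode**, coefficient form: at a good ordinary
prime `p`, for the newform `f` of `E = W/ℚ`, if some coefficient `[T^k] L_p(f, α_p, T)` with
`k ≤ r_an + 1` is non-zero then `ord_{T=0} L_p(f, α_p, T) ≤ r_an(E)`.
[cite: GreenbergLNM1716, §5 (p. 181)] -/
theorem order_le_analyticRank_of_coeff_ne_zero (hord : IsOrdinaryAt W p) {N : ℕ} [NeZero N]
    {f : CuspForm (CongruenceSubgroup.Gamma0 N) 2} (hf : IsNewformOf W f) {k : ℕ}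
    (hk : k ≤ W.analyticRank + 1)
    (hc : PowerSeries.coeff k (padicLFunction f (unitRoot W p : ℚ_[p])) ≠ 0) :
    (padicLFunction f (unitRoot W p : ℚ_[p])).order ≤ (W.analyticRank : ℕ∞) := by
  rw [order_le_analyticRank_iff_lt_add_two W p hord hf]
  exact lt_of_le_of_lt (PowerSeries.order_le k hc)
    (by exact_mod_cast (show k < W.analyticRank + 2 by omega))

/-- **Lower bound in analytic rank `≤ 2`.** At a good ordinary prime `p`, for the newform `f` of
`E = W/ℚ`: if `r_an(E) ≤ 2` then `r_an(E) ≤ ord_{T=0} L_p(f, α_p, T)` (rank `0`: trivial; rank `1`: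
`L_p(E,0) = 0` by interpolation, `one_le_order_padicLFunction_of_analyticRank_ne_zero`; rank `2`:
moreover the order is even, `stub_two_le_order_of_analyticRank_eq_two`). For `r_an ≥ 3` no lower
bound beyond `≥ 1` and parity is proved here. [cite: GreenbergLNM1716, §5 (p. 181)] -/
theorem analyticRank_le_order_of_analyticRank_le_two (hord : IsOrdinaryAt W p) {N : ℕ} [NeZero N]
    {f : CuspForm (CongruenceSubgroup.Gamma0 N) 2} (hf : IsNewformOf W f)
    (h2 : W.analyticRank ≤ 2) :
    (W.analyticRank : ℕ∞) ≤ (padicLFunction f (unitRoot W p : ℚ_[p])).order := by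
  rcases Nat.lt_or_ge W.analyticRank 1 with h0 | h1
  · have h0' : W.analyticRank = 0 := by omega
    rw [h0', Nat.cast_zero]
    exact zero_le
  rcases Nat.lt_or_ge W.analyticRank 2 with h1' | h2'
  · have h1e : W.analyticRank = 1 := by omega
    rw [h1e, Nat.cast_one]
    exact one_le_order_padicLFunction_of_analyticRank_ne_zero W p hord hf (by omega)
  · have h2e : W.analyticRank = 2 := by omega
    rw [h2e]
    exact_mod_cast stub_two_le_order_of_analyticRank_eq_two W p hord f hf h2e

/-- **In analytic rank `≤ 2`: `ord = r_an` or `r_an + 2 ≤ ord`.** At a good ordinary prime `p`,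
for the newform `f` of `E = W/ℚ` with `r_an(E) ≤ 2`, the comparison of crux #2
(`ord_{T=0} L_p = r_an`) at `(E, p)` holds unless `T^{r_an+2} ∣ L_p(E,T)`
(`analyticRank_le_order_of_analyticRank_le_two` with `order_le_analyticRank_or_add_two_le`).
[cite: GreenbergLNM1716, §5 (p. 181)] -/
theorem order_eq_analyticRank_or_add_two_le_of_analyticRank_le_two (hord : IsOrdinaryAt W p)
    {N : ℕ} [NeZero N] {f : CuspForm (CongruenceSubgroup.Gamma0 N) 2} (hf : IsNewformOf W f)
    (h2 : W.analyticRank ≤ 2) :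
    (padicLFunction f (unitRoot W p : ℚ_[p])).order = W.analyticRank ∨
      ((W.analyticRank + 2 : ℕ) : ℕ∞) ≤ (padicLFunction f (unitRoot W p : ℚ_[p])).order := by
  rcases order_le_analyticRank_or_add_two_le W p hord hf with h | h
  · exact Or.inl (le_antisymm h (analyticRank_le_order_of_analyticRank_le_two W p hord hf h2))
  · exact Or.inr h

/-- **Analytic rank one: `ord = 1` or `3 ≤ ord`.** At a good ordinary prime `p`, for the newform
`f` of `E = W/ℚ` of analytic rank `1`: `ord_{T=0} L_p(f, α_p, T) = 1` unless `T³ ∣ L_p(E,T)`. So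
the rank-one case of `stub_UB_pos` at `p` (weak rank-one Schneider at one prime, via
Perrin-Riou's `p`-adic Gross–Zagier formula) is exactly `T³ ∤ L_p(E,T)`.
[cite: GreenbergLNM1716, §5 (p. 181)] -/
theorem order_eq_one_or_three_le_of_analyticRank_eq_one (hord : IsOrdinaryAt W p) {N : ℕ}
    [NeZero N] {f : CuspForm (CongruenceSubgroup.Gamma0 N) 2} (hf : IsNewformOf W f)
    (h1 : W.analyticRank = 1) :
    (padicLFunction f (unitRoot W p : ℚ_[p])).order = 1 ∨
      (3 : ℕ∞) ≤ (padicLFunction f (unitRoot W p : ℚ_[p])).order := by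
  rcases order_eq_analyticRank_or_add_two_le_of_analyticRank_le_two W p hord hf (by omega)
    with h | h
  · rw [h1, Nat.cast_one] at h
    exact Or.inl h
  · rw [h1] at h
    exact Or.inr (by exact_mod_cast h)

/-- **Analytic rank two: `ord = 2` or `4 ≤ ord`.** At a good ordinary prime `p`, for the newform
`f` of `E = W/ℚ` of analytic rank `2`: `ord_{T=0} L_p(f, α_p, T) = 2` unless `T⁴ ∣ L_p(E,T)`.
[cite: GreenbergLNM1716, §5 (p. 181)] -/
theorem order_eq_two_or_four_le_of_analyticRank_eq_two (hord : IsOrdinaryAt W p) {N : ℕ}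
    [NeZero N] {f : CuspForm (CongruenceSubgroup.Gamma0 N) 2} (hf : IsNewformOf W f)
    (h2 : W.analyticRank = 2) :
    (padicLFunction f (unitRoot W p : ℚ_[p])).order = 2 ∨
      (4 : ℕ∞) ≤ (padicLFunction f (unitRoot W p : ℚ_[p])).order := by
  rcases order_eq_analyticRank_or_add_two_le_of_analyticRank_le_two W p hord hf (by omega)
    with h | h
  · rw [h2] at h
    exact Or.inl (by exact_mod_cast h)
  · rw [h2] at h
    exact Or.inr (by exact_mod_cast h)

/-- **The proved envelope of `stub_UB_pos`.** For `E = W/ℚ` elliptic, globally minimal, of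
positive analytic rank, there is a good ordinary prime `p ≥ 5`
(`WeierstrassCurve.exists_good_ordinary_prime_holds`, Serre 1981, §8) at which, for every newform
`f` of `E`: `1 ≤ ord_{T=0} L_p(f, α_p, T) < ⊤`, `ord ≡ r_an (mod 2)`, and `ord ≤ r_an` or
`r_an + 2 ≤ ord`. The registered stub asks for the first disjunct; everything else in its
conclusion is a theorem (and holds at EVERY good ordinary prime). [cite: Serre1981, §8] -/
theorem stub_UB_pos_envelope :
    ∀ (W : WeierstrassCurve ℚ) [W.IsElliptic] [W.IsGloballyMinimal], 0 < W.analyticRank →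
      ∃ (p : ℕ) (_ : Fact p.Prime), 5 ≤ p ∧ IsOrdinaryAt W p ∧
        ∀ {N : ℕ} [NeZero N] (f : CuspForm (CongruenceSubgroup.Gamma0 N) 2), IsNewformOf W f →
          (1 : ℕ∞) ≤ (padicLFunction f (unitRoot W p : ℚ_[p])).order ∧
          (padicLFunction f (unitRoot W p : ℚ_[p])).order < ⊤ ∧
          (Even (padicLFunction f (unitRoot W p : ℚ_[p])).order.toNat ↔ Even W.analyticRank) ∧
          ((padicLFunction f (unitRoot W p : ℚ_[p])).order ≤ (W.analyticRank : ℕ∞) ∨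
            ((W.analyticRank + 2 : ℕ) : ℕ∞) ≤ (padicLFunction f (unitRoot W p : ℚ_[p])).order) := by
  intro W _ _ hpos
  obtain ⟨p, hp, h5, hgood, hnd⟩ := WeierstrassCurve.exists_good_ordinary_prime_holds W
  have hord : IsOrdinaryAt W p := ⟨hgood, hnd⟩
  exact ⟨p, hp, h5, hord, fun f hf ↦
    ⟨one_le_order_padicLFunction_of_analyticRank_ne_zero W p hord hf hpos.ne',
      order_padicLFunction_lt_top W p hord hf, stub_even_order_iff_even_analyticRank W p hord f hf,
      order_le_analyticRank_or_add_two_le W p hord hf⟩⟩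

/-- **`stub_UB_pos` from the formally weaker one-prime statement `ord < r_an + 2`.** If every
`E = W/ℚ` (elliptic, globally minimal) of positive analytic rank has a good ordinary prime `p ≥ 5`
with `ord_{T=0} L_p(f, α_p, T) < r_an(E) + 2` for every newform `f` (equivalently
`T^{r_an+2} ∤ L_p(E,T)`), then the registered signature of `stub_UB_pos` holds
(`order_le_analyticRank_iff_lt_add_two`: parity closes the gap). [cite: GreenbergLNM1716, §5 (p. 181)] -/
theorem stub_UB_pos_of_order_lt_add_two :
    (∀ (W : WeierstrassCurve ℚ) [W.IsElliptic] [W.IsGloballyMinimal], 0 < W.analyticRank →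
      ∃ (p : ℕ) (_ : Fact p.Prime), 5 ≤ p ∧ IsOrdinaryAt W p ∧
        ∀ {N : ℕ} [NeZero N] (f : CuspForm (CongruenceSubgroup.Gamma0 N) 2), IsNewformOf W f →
          (padicLFunction f (unitRoot W p : ℚ_[p])).order < ((W.analyticRank + 2 : ℕ) : ℕ∞)) →
    ∀ (W : WeierstrassCurve ℚ) [W.IsElliptic] [W.IsGloballyMinimal], 0 < W.analyticRank →
      ∃ (p : ℕ) (_ : Fact p.Prime), 5 ≤ p ∧ IsOrdinaryAt W p ∧
        ∀ {N : ℕ} [NeZero N] (f : CuspForm (CongruenceSubgroup.Gamma0 N) 2), IsNewformOf W f →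
          (padicLFunction f (unitRoot W p : ℚ_[p])).order ≤ (W.analyticRank : ℕ∞) := by
  intro h W _ _ hpos
  obtain ⟨p, hp, h5, hord, hlt⟩ := h W hpos
  exact ⟨p, hp, h5, hord, fun f hf ↦ (order_le_analyticRank_iff_lt_add_two W p hord hf).mpr (hlt f hf)⟩

end Summit.BirchSwinnertonDyer.BirchSwinnertonDyer.Cruxes.PAdicOrderThesisR2.KatoSandwich
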